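import Summits.FinalStateConjecture.FinalStateConjecture.Theorems.PhotonSphereChannelsTameEternalLimitDefs
import Summits.FinalStateConjecture.FinalStateConjecture.Theorems.PhotonSphereChannelsChannelsResolveTameDevelopmentsRTrappedSetMinkowskiLimit
import Literature.Geometry.Lorentzian.MinkowskiGlobalHyperbolicity
import Literature.Geometry.Lorentzian.MinkowskiFlat
import Literature.Geometry.Lorentzian.KerrSchildCoord
import HarnessLib

/-!
# Crux `ChannelsResolveTameDevelopmentsR` (stmt-FinalStateConjecture-14075), line
# `trapped-set-observability-analyticity` — stub `stub_analyticRigidity` (S6), audit (A1)/(A3):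
# stationary components are strip-analytic; the flat disjunct of S6 is honestly realised

Stub S6 of the line (`stub_analyticRigidity`) says: a `TameEternalLimit` with red-shifted horizon,
presented by `Ξ` on the cylinder `cyl a r₀ = {x ∈ E4 | r₀ < r(a, x)}` with presented components
`G = Ξ^* g` STRIP-ANALYTIC in `t` (`StripAnalytic a r₀ G`: `∃ σ > 0, ∃ C`, every
`s ↦ G(x + s e₀)(v, w)` is the restriction of a function holomorphic on `{|Im z| < σ}` bounded by
`C‖v‖‖w‖`), is a sub-extremal Kerr black hole or flat.  This file lands two kernel-checked audit
facts about that statement, written UNFOLDED over the Literature vocabulary (the line's `Defs` of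
`cyl` / `StripAnalytic` / `IsPresentedDarkExterior` are not in the tree; the cylinder is the set
`{x : E4 | r₀ < Kerr.radius a x}` as in the landed S3/S4 helpers):

* `§1` (audit A3, registered sub-goal `stub_stripAnalyticOfStationary`): components which are
  `t`-INDEPENDENT on the cylinder and bounded there (clause 5 of `IsPresentedDarkExterior`,
  `‖D^k G‖ ≤ C_k`, at `k = 0`) are strip-analytic for EVERY strip width `σ > 0`, with the constant
  holomorphic extension `F ≡ G(x)(v, w)`.  Consequence for the lead (triage r1-3 (c)): on the
  stationary members of S6's hypothesis class the strip hypothesis is EMPTY, so S6 contains verbatim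
  the smooth stationary black-hole uniqueness problem (`EternalPapapetrou.EternalStationaryExteriorIsKerr`,
  stmt-10745) and, on horizonless members, the stationary no-geon problem.
* `§2` (audit A1, registered sub-goal `stub_flatDisjunctRealised`): the disjunct `E.IsFlat`
  (`E.Z.metric.leviCivita.IsFlat`, the curvature TENSOR of the Levi-Civita connection vanishes) is
  not junk: under `[HasLeviCivita]` the Levi-Civita connection of a smooth metric is locally `C¹`,
  so its curvature tensor is the honest one (`curvatureTensorialAt_of_isLocallyContMDiff_holds`),
  and for the Minkowski member of the class (the witness of `stub_tameEternalLimitNonempty`,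
  rebuilt inline from the landed helpers of that file) it vanishes by O'Neill's Lemma 3.14
  (`isFlat_leviCivita_of_val_eq_const`): S6's conclusion `IsKerrBlackHole ∨ IsFlat` HOLDS, honestly,
  at the dispersive member of its hypothesis class.
-/

set_option linter.dupNamespace false

noncomputable section

namespace Summit.FinalStateConjecture.FinalStateConjecture.Theorems.TrappedSet

open Literature.Geometry.Lorentzian
open Summit.FinalStateConjecture.FinalStateConjecture.Theorems.ZeroEnergyRigidity.Negative
open scoped Manifold ContDiff Topology ENNReal NNReal
open Filter Set Function TopologicalSpace

/-! ## §1 Stationary bounded components are strip-analytic (audit A3) -/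

section Stationary

/-- **A `t`-independent bounded field of bilinear forms is strip-analytic in `t`, for every strip.**
If `G (x + s e₀) = G x` for all `x ∈ S` and all `s`, and `‖G x‖ ≤ C` on `S`, then for every `σ`
each component `s ↦ G(x + s e₀)(v, w)`, `x ∈ S`, is the restriction to `ℝ` of the CONSTANT function
`F ≡ G(x)(v, w)`, holomorphic on `{|Im z| < σ}` and bounded by `C‖v‖‖w‖`
(`‖G x v w‖ ≤ ‖G x‖‖v‖‖w‖`). [folklore] -/
theorem stripAnalytic_clause_of_stationary {S : Set E4} {G : E4 → E4 →L[ℝ] E4 →L[ℝ] ℝ} {C : ℝ}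
    (hstat : ∀ x ∈ S, ∀ s : ℝ, G (x + s • E4.basisVector 0) = G x) (hC : ∀ x ∈ S, ‖G x‖ ≤ C)
    (σ : ℝ) :
    ∀ x ∈ S, ∀ v w : E4, ∃ F : ℂ → ℂ,
      DifferentiableOn ℂ F {z : ℂ | |z.im| < σ} ∧ (∀ z : ℂ, |z.im| < σ → ‖F z‖ ≤ C * ‖v‖ * ‖w‖) ∧
        ∀ s : ℝ, F (s : ℂ) = ((G (x + s • E4.basisVector 0) v w : ℝ) : ℂ) := by
  intro x hx v w
  refine ⟨fun _ ↦ ((G x v w : ℝ) : ℂ), differentiableOn_const _, fun z _ ↦ ?_, fun s ↦ ?_⟩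
  · rw [Complex.norm_real]
    calc ‖G x v w‖ ≤ ‖G x‖ * ‖v‖ * ‖w‖ := (G x).le_opNorm₂ v w
      _ ≤ C * ‖v‖ * ‖w‖ := by gcongr; exact hC x hx
  · rw [hstat x hx s]

/-- Registered sub-goal `stub_stripAnalyticOfStationary` of `stub_analyticRigidity` (S6), audit
(A3): **on the stationary members of the presented class the strip hypothesis of S6 is empty.**
For components `G` on the presentation cylinder `{r₀ < r(a,·)}` which obey clause 5 of
`IsPresentedDarkExterior` (every `‖D^k G‖` and `‖G⁻¹‖` bounded on the cylinder; only `k = 0` is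
used, `‖D⁰G x‖ = ‖G x‖`) and are `t`-independent there, the conclusion `StripAnalytic a r₀ G` of
S5 / hypothesis of S6 holds (unfolded verbatim; witness `σ = 1`, `F` constant).  Hence S6
restricted to `t`-independent presented limits is literally "a stationary red-shifted presented tame
eternal vacuum limit is sub-extremal Kerr or flat" — the smooth no-hair / no-geon problem, with no
analytic input left (triage r1-3 (c)). [folklore] -/
theorem stub_stripAnalyticOfStationary :
    ∀ (a r₀ : ℝ) (G : E4 → E4 →L[ℝ] E4 →L[ℝ] ℝ),
      (∀ k : ℕ, ∃ C : ℝ, ∀ x ∈ {x : E4 | r₀ < Kerr.radius a x}, ‖iteratedFDeriv ℝ k G x‖ ≤ C ∧ ‖MetricCoord.sharpAt G x‖ ≤ C) →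
      (∀ x ∈ {x : E4 | r₀ < Kerr.radius a x}, ∀ s : ℝ, G (x + s • E4.basisVector 0) = G x) →
        ∃ σ C : ℝ, 0 < σ ∧ ∀ x ∈ {x : E4 | r₀ < Kerr.radius a x}, ∀ v w : E4, ∃ F : ℂ → ℂ,
          DifferentiableOn ℂ F {z : ℂ | |z.im| < σ} ∧ (∀ z : ℂ, |z.im| < σ → ‖F z‖ ≤ C * ‖v‖ * ‖w‖) ∧
            ∀ s : ℝ, F (s : ℂ) = ((G (x + s • E4.basisVector 0) v w : ℝ) : ℂ) := by
  intro a r₀ G hbd hstat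
  obtain ⟨C, hC⟩ := hbd 0
  refine ⟨1, C, one_pos, stripAnalytic_clause_of_stationary hstat (fun x hx ↦ ?_) 1⟩
  have h := (hC x hx).1
  rwa [norm_iteratedFDeriv_zero] at h

end Stationary

/-! ## §2 The flat disjunct of S6 is honest and realised (audit A1) -/

section FlatDisjunct

/-- **Minkowski spacetime is flat in the sense of S6's disjunct `IsFlat`**: the curvature tensor of
the Levi-Civita connection of `(ℝ⁴, η)` (`Minkowski.spacetime`, metric components constant `= η`)
vanishes identically — O'Neill 1983, Ch. 3, Lemma 3.14 and the remark after Prop. 3.41 (every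
semi-Euclidean space is flat), here `isFlat_leviCivita_of_val_eq_const`.
[cite: ONeillSemiRiemannian1983, Ch. 3, remark after Prop. 3.41 (p. 80)] -/
theorem isFlat_leviCivita_minkowskiSpacetime
    [h : Minkowski.spacetime.metric.toPseudoRiemannianMetric.HasLeviCivita] :
    Minkowski.spacetime.metric.leviCivita.IsFlat := by
  haveI : Minkowski.smoothMetric.toPseudoRiemannianMetric.HasLeviCivita := h
  exact Minkowski.smoothMetric.toPseudoRiemannianMetric.isFlat_leviCivita_of_val_eq_const
    Minkowski.bilin (fun _ ↦ rfl) (by decide)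

/-- Registered sub-goal `stub_flatDisjunctRealised` of `stub_analyticRigidity` (S6), audit (A1):
**the conclusion `IsKerrBlackHole ∨ IsFlat` of S6 holds — honestly, through the flat disjunct — at a
horizonless member of its hypothesis class**, namely exact Minkowski space packaged as a
`TameEternalLimit` exactly as in `stub_tameEternalLimitNonempty` (far chart the inclusion of
`ℝ_t × {|x| > 1}`, clock `x⁰`, `L = 0`, empty horizon, d.o.c. everything; every field a theorem of
that landed file).  `IsFlat` unfolds to `Z.metric.leviCivita.IsFlat`, the vanishing of the curvature
TENSOR of the Levi-Civita connection, which for a smooth metric under `[HasLeviCivita]` is the honest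
Riemann tensor (the connection is locally `C¹`), here zero by `isFlat_leviCivita_minkowskiSpacetime`.
[folklore] -/
theorem stub_flatDisjunctRealised :
    ∃ E : TameEternalLimit, E.horizon = ∅ ∧ E.doc = Set.univ ∧
      ∀ [E.Z.metric.toPseudoRiemannianMetric.HasLeviCivita], E.IsKerrBlackHole ∨ E.IsFlat := by
  refine ⟨
    { Z := Minkowski.spacetime
      z := (0 : E4)
      M := 0
      R := 1
      Φ := Subtype.val
      t := fun x : E4 ↦ x 0
      L := fun _ ↦ 0
      mass_nonneg := le_rfl
      lt_R := by norm_num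
      isRicciFlat := by
        intro hLC
        haveI : Minkowski.smoothMetric.toPseudoRiemannianMetric.HasLeviCivita := hLC
        exact Minkowski.isRicciFlat_holds
      isGloballyHyperbolic := Minkowski.isGloballyHyperbolic
      subset_chronologicalFuture := by
        change (univ : Set E4) ⊆ (LorentzianMetric.ofLE (n' := (∞ : ℕ∞ω)) Minkowski.metric le_top).chronologicalFuture
          (TimeOrientation.ofLE (n' := (∞ : ℕ∞ω)) Minkowski.timeOrientation le_top)
          (Set.range (Subtype.val : Kerr.region (0 : ℝ) 1 → E4))
        rw [chronologicalFuture_farCylinder_eq_univ]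
      isLocalDiffeomorph_far := isLocalDiffeomorph_subtypeVal_minkowski _
      injective_far := Subtype.val_injective
      far_bounds k := ⟨0, fun m _ x ↦ by
        rw [deviationExtend_minkowski_farChart, iteratedFDeriv_zero (𝕜 := ℝ)]
        simp⟩
      far_nonradiating m δ hδ := ⟨0, fun x _ ↦ by
        have h0 : (fun y : E4 ↦ fderiv ℝ (Minkowski.spacetime.deviationExtend (farBackground 0 1)
            (Subtype.val : Kerr.region (0 : ℝ) 1 → E4)) y (Literature.Geometry.Lorentzian.E4.basisVector 0)) = 0 := by
          funext y
          rw [deviationExtend_minkowski_farChart]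
          simp
        rw [h0, iteratedFDeriv_zero (𝕜 := ℝ)]
        simpa using hδ.le⟩
      far_clock _ := rfl
      contMDiff_clock := contMDiff_iff_contDiff.mpr (contDiff_piLp_apply (p := 2))
      tame k := ⟨1, one_pos, 0, fun q _ ↦ tameClockChartAt_minkowski k one_pos 0 q⟩
      basepoint_mem := by
        change (0 : E4) ∈ closure (Minkowski.spacetime.docOfEnd
          (Set.range (Subtype.val : Kerr.region (0 : ℝ) 1 → E4)))
        rw [docOfEnd_farCylinder_eq_univ, closure_univ]
        exact mem_univ _
      contMDiffOn_generator := ⟨∅, isOpen_empty, by rw [futureEventHorizonOfEnd_farCylinder_eq_empty],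
        fun _ h ↦ h.elim⟩
      generator_null p hp := by
        rw [futureEventHorizonOfEnd_farCylinder_eq_empty] at hp
        exact hp.elim
      generator_tangent γ _ h0 := by
        rw [futureEventHorizonOfEnd_farCylinder_eq_empty] at h0
        exact h0.elim
      generator_complete p hp := by
        rw [futureEventHorizonOfEnd_farCylinder_eq_empty] at hp
        exact hp.elim
      horizon_regular := by
        refine ⟨∅, fun _ ↦ 0, isOpen_empty, ?_, fun _ h ↦ h.elim, ?_, ?_⟩
        · rw [futureEventHorizonOfEnd_farCylinder_eq_empty]
        · rw [futureEventHorizonOfEnd_farCylinder_eq_empty]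
          ext p
          simp
        · intro p hp
          rw [futureEventHorizonOfEnd_farCylinder_eq_empty] at hp
          exact hp.elim
      isCompact_horizonSlice c := by
        rw [futureEventHorizonOfEnd_farCylinder_eq_empty, empty_inter]
        exact isCompact_empty
      nonexpanding := by
        intro _ p hp
        rw [futureEventHorizonOfEnd_farCylinder_eq_empty] at hp
        exact hp.elim }, ?_, ?_, ?_⟩
  · change Minkowski.spacetime.futureEventHorizonOfEnd
      (Set.range (Subtype.val : Kerr.region (0 : ℝ) 1 → E4)) = ∅
    exact futureEventHorizonOfEnd_farCylinder_eq_empty 1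
  · change Minkowski.spacetime.docOfEnd (Set.range (Subtype.val : Kerr.region (0 : ℝ) 1 → E4)) = univ
    exact docOfEnd_farCylinder_eq_univ 1
  · intro hLC
    exact Or.inr isFlat_leviCivita_minkowskiSpacetime

end FlatDisjunct

end Summit.FinalStateConjecture.FinalStateConjecture.Theorems.TrappedSet

end
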